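import Literature.MathematicalPhysics.QuantumFieldTheory.Balaban1983to89.B9Thm311ReadingCoords
import Literature.MathematicalPhysics.QuantumFieldTheory.Balaban1983to89.Node00.OpsYDeltaA

/-!
# `Balaban1983to89.B9Thm311ReadingAtLetters` — row 17 of the N06 knit ([B9] Theorem 3.11, p. 416): the five operators
# Δ′_a(U), G′(U), (Q′G′²Q′\*)⁻¹(U), Δ_a(U), G(U) PINNED to def-Y's genuine letters, the positivity reading in GENUINE CURRENCY,
# the algebraic inputs of the printed proof DISCHARGED, and row 17 at `opsYOfLetters` ∕ `opsYOfRecord`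

T. Bałaban, *Propagators for lattice gauge theories in a background field*, Commun. Math. Phys. **99** (1985) 389–434
[`Balaban1985BackgroundPropagators`, "B9"]; [3] = T. Bałaban, *Propagators and renormalization transformations for lattice
gauge theories. I*, Commun. Math. Phys. **95** (1984) 17–40 [`Balaban1984PropagatorsI`].

statement-level skeleton of published theorems with citation tags; proofs where landed; nothing here is a claim about the
Yang–Mills mass gap

THE PRINTED LOCUS (verbatim, p. 416): *"Theorem 3.11. Under the assumptions of the Theorems 3.1–3.10 (i.e. for M sufficiently
large and α₀ sufficiently small) the operators Δ′_a, G′, (Q′G′²Q′\*)⁻¹, Δ_a, G are positive definite.  This is obvious for the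
first three operators, and also for P and R, hence it is enough to prove it for G. It is a symmetric and invertible operator, so
if it is not positive, then there exists A₀ ≠ 0, λ₀ > 0 such that GA₀ = −λ₀A₀. By (3.106) G = G₀(I − R)⁻¹, R is an operator
with small norm. Let us assume that the operator G₀ is positive …"*; (3.25) p. 395: *"G′ = G′(U) = (Δ′_a)⁻¹"*; (3.27) p. 395:
*"G(U) = Δ_a(U)⁻¹"*; [3] p. 25: *"⟨ω, Q′_kG′_k²Q′\*_kω⟩ = ‖G′_kQ′\*_kω‖² = 0, then Q′\*_kω = 0, hence ω = 0."*

WHY THIS FILE (the row-17 twin of `B9Thm39ReadingAtLetters`).  In n06-d's whole-statement certificate at def-Y's instance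
(`…N06AtOpsYOfRecordB`, rows 17 block) Theorem 3.11's letters are a binder `𝔬311 : ∀ x, Ops311 (bg9Y …) (E7 x) (F7 x) (W7 x)` on
FREE carrier types with no pin to def-Y's letters, and the record's positivity field `(opsYOfRecord … 𝔈 x).PosDef = (𝔈 x).PosDef`
is a free predicate letter: the pin `hPD : … = PosDefOfOps (𝔬311 x)` is dischargeable by choice but then row 17 speaks about five
ARBITRARY abstract operators — no content about the genuine Δ′_a(U), G′(U), (Q′G′²Q′\*)⁻¹(U), Δ_a(U), G(U), all of which def-Y's v2
letters HAVE (`deltaPrimeAY`, `GpY = Ring.inverse Δ′_a`, `QpY ∕ QpsY`, `XY = Q′∘G′∘G′∘Q′\*`, `XinvY`, `deltaAY`, `GAY = Ring.inverse Δ_a`).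
THIS FILE supplies the reading: on the weighted real trace coordinates of `B9Thm311ReadingCoords` (sites and fine bonds weight 1,
blocks the block volume `W` — the weight making Q′\* the adjoint of Q′, [4] (2.69) ∕ `QsM_transpose`) the record `ops311Y x 𝔏 𝔔 :
Ops311 …` PINS the five operators (and Q′, Q′\*) to def-Y's letters by conjugation; only G₀ = Σ_□h_□G_□h_□ ((3.87)) and R ((3.105)) —
objects of Theorem 3.10's random-walk parametrix, which def-Y does not construct — stay free proof letters `𝔔 : ProofLetters311`.
Then `PosDefOfOps (ops311Y x 𝔏 𝔔) n U` UNFOLDS to positivity of the genuine n-th operator in print's scalar product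
(`posDefOfOps_ops311Y_{zero,…,four}`), the purely algebraic inputs `gp_right ∕ c_right ∕ da_right` of `B9Thm311Whole.Inputs311` are
DISCHARGED at the pins `𝔏.Gp = GpY _ 𝔏.parS`, `𝔏.GA = GAY _ 𝔏.parS 𝔏.parB 𝔏.Gp` (two-sided inverses of units; `IsUnit Δ′_a(U)` from the
displayed positivity; ★ `IsUnit (Q′G′²Q′\*)(U)` DERIVED by [3] p. 25's `posDef_qggqs` from the displayed adjointness ∕ symmetry ∕
injectivity), and row 17 follows at `opsYOfLetters N θ M⋆ 𝔏 𝔈` ∕ `opsYOfRecord N θ M⋆ 𝔈` from the pin `hPD` and ONE displayed schema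
`Inputs311Y` whose clauses are printed-shape statements about GENUINE operators.

* §1 carriers and charts at an index: `E311 ∕ F311 ∕ W311`, `wB` (`wB_pos`), `eS311 ∕ eB311 ∕ eF311`; `ProofLetters311`; ★ `ops311Y`.
* §2 the reading in genuine currency: `posDefOfOps_ops311Y_zero ∕ _one ∕ _two ∕ _three ∕ _four`.
* §3 the displayed schema `Inputs311Y` (genuine currency); `isUnit_deltaPrimeAY_of_inputs311Y`, ★ `isUnit_XY_of_inputs311Y` ([3] p. 25 at the
  letters), ★★ `inputs311_ops311Y` (`Inputs311Y … U → Inputs311 (ops311Y x 𝔏 𝔔) θ₁ M U`).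
* §4 at the record's carriers: ★★ `t311_of_pins_opsYOfLetters`, ★★ `t311_of_pins_opsYOfRecord` (`hGp`, `hGA` by `rfl`).

HONEST SCOPE.  DISPLAYED (hypotheses of printed shape about def-Y's genuine operators, NOT proved here): Δ′_a(U) positive and
symmetric (*"obvious"*, p. 394 regularity), Q′\*(U) the adjoint of Q′(U) for the block weight and injective ([3] p. 25 — true at
unitary transporters, i.e. under (3.35)'s «U is G-valued», not derived here), Δ_a(U) invertible (Thm 3.3 ∕ (3.106): G exists), G(U)
symmetric, G₀ positive, G₀ = G(I − R) ((3.105)–(3.106)), ⟨A, RA⟩ ≦ θ₁M⁻¹⟨A, A⟩ (GAPS G-B9-06).  DISCHARGED: the two-sided inverse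
identities and the invertibility of (Q′G′²Q′\*)(U).  Nothing of [B9] is asserted; NOT a node discharge, NOT summit progress;
count-neutral; one finite 𝕋⁴ programme — nothing continuum, nothing about the mass gap.  Cell `pub-ymgap` (HUMAN RULING D-0062),
Track A node N06 [B9], seat `pub-ymgap-dag-n06-j` (harness re-seat gen 6), 2026-08-27.
-/

namespace Literature.MathematicalPhysics.QuantumFieldTheory.Balaban1983to89.B9Thm311ReadingAtLetters

open Literature.MathematicalPhysics.QuantumFieldTheory.Balaban1983to89
open B9Thm311Whole B9Thm311ReadingCoords Node00
open B6KLevelCensusIndexV1 B6Ineq268MultiLevelBox B9PinMembersKLevelV1 B9PinGeometryKLevelV1 B7Prop2SpecialUnitary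

noncomputable section

/-! ## §1 Carriers, charts and the pinned letters at a member -/

section Carrier

open scoped Matrix.Norms.L2Operator

variable {d ℓ : ℕ} {hd : 1 ≤ d + 1} {hL : Odd (ℓ + 1) ∧ 1 < ℓ + 1} {b₀ b₁ : ℝ} {Mstar : ℕ}
variable (N : ℕ) (i : KIdx d ℓ hd hL b₀ b₁)

/-- the Theorem-3.11 SITE carrier `E`: weighted real trace coordinates of `M_N(ℂ)`-valued site functions (weight 1).
[cite: Balaban1985BackgroundPropagators, p.393 (scalar products), dictionary] -/
abbrev E311 : Type := EuclideanSpace ℝ (Idx311 (SiteY i) (Fin N))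
/-- the Theorem-3.11 BLOCK carrier `F = L²(𝔅)`: coordinates of `M_N(ℂ)`-valued block functions, block weight `W`.
[cite: Balaban1985BackgroundPropagators, p.393; Balaban1984PropagatorsII, (2.69) p.235, dictionary] -/
abbrev F311 : Type := EuclideanSpace ℝ (Idx311 (BlkY i) (Fin N))
/-- the Theorem-3.11 BOND carrier `W`: coordinates of `M_N(ℂ)`-valued fine-bond functions (weight 1).
[cite: Balaban1985BackgroundPropagators, p.393 (scalar products), dictionary] -/
abbrev W311 : Type := EuclideanSpace ℝ (Idx311 (FBondY i) (Fin N))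

/-- the block weight: the block volume `W(y) = (L^{j(y)})^{d+1}` of [4] (2.69) (the weight for which Q′\* is the adjoint of Q′:
`QsM_transpose`). [cite: Balaban1984PropagatorsII, (2.69) p.235] -/
def wB : BlkY i → ℝ := fun s => W i.D.toDomains s

/-- the block weight is positive. [cite: Balaban1984PropagatorsII, (2.69) p.235, bookkeeping] -/
theorem wB_pos (s : BlkY i) : 0 < wB i s := W_pos _ s

/-- the site chart (weight 1). [cite: Balaban1985BackgroundPropagators, p.393, dictionary] -/
def eS311 : (SiteY i → Matrix (Fin N) (Fin N) ℂ) ≃ₗ[ℝ] E311 N i := realify311 (fun _ => (1 : ℝ)) fun _ => one_pos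
/-- the block chart (block weight `W`). [cite: Balaban1984PropagatorsII, (2.69) p.235, dictionary] -/
def eB311 : (BlkY i → Matrix (Fin N) (Fin N) ℂ) ≃ₗ[ℝ] F311 N i := realify311 (wB i) (wB_pos i)
/-- the bond chart (weight 1). [cite: Balaban1985BackgroundPropagators, p.393, dictionary] -/
def eF311 : (FBondY i → Matrix (Fin N) (Fin N) ℂ) ≃ₗ[ℝ] W311 N i := realify311 (fun _ => (1 : ℝ)) fun _ => one_pos

/-- **THE FREE PROOF LETTERS OF THEOREM 3.11**: `G0 U` = G₀ = Σ_□h_□G_□h_□ ((3.87) p. 409) and `R U` = R of (3.105) (Δ_aG₀ = I − R), on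
`M_N(ℂ)`-valued fine-bond functions — objects of Theorem 3.10's random-walk parametrix, NOT constructed by def-Y's letters; a PARAMETER
RECORD. [cite: Balaban1985BackgroundPropagators, (3.87) p.409, (3.105)–(3.106) p.414] -/
structure ProofLetters311 (N : ℕ) (i : KIdx d ℓ hd hL b₀ b₁) where
  G0 : CfgY (Matrix (Fin N) (Fin N) ℂ) i → (FBondY i → Matrix (Fin N) (Fin N) ℂ) →ₗ[ℂ] (FBondY i → Matrix (Fin N) (Fin N) ℂ)
  R : CfgY (Matrix (Fin N) (Fin N) ℂ) i → (FBondY i → Matrix (Fin N) (Fin N) ℂ) →ₗ[ℂ] (FBondY i → Matrix (Fin N) (Fin N) ℂ)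

variable {N}

/-- ★ **THEOREM 3.11's LETTERS PINNED TO def-Y's GENUINE LETTERS** at a member `x` with covariant letters `𝔏` and free proof letters `𝔔`:
`DeltaPa U` = Δ′_a(U) (`deltaPrimeAY _ 𝔏.parS U`), `Gp U` = `𝔏.Gp U` (G′(U)), `Qp ∕ Qps` = `QpY ∕ QpsY _ 𝔏.parS U`, `Cinv U` = (Q′G′²Q′\*)⁻¹(U)
(`XinvY _ 𝔏.parS 𝔏.Gp U`), `DeltaA U` = Δ_a(U) (`deltaAY _ 𝔏.parS 𝔏.parB 𝔏.Gp U`), `GA U` = `𝔏.GA U` (G(U)), `G0 ∕ R` = `𝔔`'s — each conjugated into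
the weighted real trace coordinates. [cite: Balaban1985BackgroundPropagators, Thm 3.11 p.416 + (3.24)–(3.27) pp.394–395 + (3.87) p.409 + (3.105)–(3.106) p.414] -/
def ops311Y (x : MemberY d ℓ hd hL b₀ b₁ Mstar) (𝔏 : CovLettersY (Matrix (Fin N) (Fin N) ℂ) x) (𝔔 : ProofLetters311 N x.toKIdx) :
    Ops311 (bg9Y (Matrix (Fin N) (Fin N) ℂ) (specialUnitaryUnits (Fin N)) x) (E311 N x.toKIdx) (F311 N x.toKIdx) (W311 N x.toKIdx) where
  DeltaPa U := conj311 (eS311 N x.toKIdx) (eS311 N x.toKIdx) (deltaPrimeAY x.toKIdx 𝔏.parS U)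
  Gp U := conj311 (eS311 N x.toKIdx) (eS311 N x.toKIdx) (𝔏.Gp U)
  Qp U := conj311 (eS311 N x.toKIdx) (eB311 N x.toKIdx) (QpY x.toKIdx 𝔏.parS U)
  Qps U := conj311 (eB311 N x.toKIdx) (eS311 N x.toKIdx) (QpsY x.toKIdx 𝔏.parS U)
  Cinv U := conj311 (eB311 N x.toKIdx) (eB311 N x.toKIdx) (XinvY x.toKIdx 𝔏.parS 𝔏.Gp U)
  G0 U := conj311 (eF311 N x.toKIdx) (eF311 N x.toKIdx) (𝔔.G0 U)
  R U := conj311 (eF311 N x.toKIdx) (eF311 N x.toKIdx) (𝔔.R U)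
  GA U := conj311 (eF311 N x.toKIdx) (eF311 N x.toKIdx) (𝔏.GA U)
  DeltaA U := conj311 (eF311 N x.toKIdx) (eF311 N x.toKIdx) (deltaAY x.toKIdx 𝔏.parS 𝔏.parB 𝔏.Gp U)

/-! ## §2 The positivity reading in genuine currency -/

variable (x : MemberY d ℓ hd hL b₀ b₁ Mstar) (𝔏 : CovLettersY (Matrix (Fin N) (Fin N) ℂ) x) (𝔔 : ProofLetters311 N x.toKIdx)

/-- entry 0 READS «Δ′_a(U) is positive definite»: `∀ Φ ≠ 0, 0 < Σ_z Re tr(Φ(z)\*(Δ′_a(U)Φ)(z))`. [cite: Balaban1985BackgroundPropagators, Thm 3.11 p.416 + (3.24) p.394] -/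
theorem posDefOfOps_ops311Y_zero (U : CfgY (Matrix (Fin N) (Fin N) ℂ) x.toKIdx) :
    PosDefOfOps (ops311Y x 𝔏 𝔔) 0 U ↔ PosDefTr (fun _ => (1 : ℝ)) (deltaPrimeAY x.toKIdx 𝔏.parS U) :=
  posDef_conj311_realify311_iff _

/-- entry 1 READS «G′(U) is positive definite». [cite: Balaban1985BackgroundPropagators, Thm 3.11 p.416 + (3.25) p.395] -/
theorem posDefOfOps_ops311Y_one (U : CfgY (Matrix (Fin N) (Fin N) ℂ) x.toKIdx) :
    PosDefOfOps (ops311Y x 𝔏 𝔔) 1 U ↔ PosDefTr (fun _ => (1 : ℝ)) (𝔏.Gp U) :=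
  posDef_conj311_realify311_iff _

/-- entry 2 READS «(Q′G′²Q′\*)⁻¹(U) is positive definite» for the block-volume scalar product. [cite: Balaban1985BackgroundPropagators, Thm 3.11 p.416 + (3.25) p.395; Balaban1984PropagatorsII, (2.69) p.235] -/
theorem posDefOfOps_ops311Y_two (U : CfgY (Matrix (Fin N) (Fin N) ℂ) x.toKIdx) :
    PosDefOfOps (ops311Y x 𝔏 𝔔) 2 U ↔ PosDefTr (wB x.toKIdx) (XinvY x.toKIdx 𝔏.parS 𝔏.Gp U) :=
  posDef_conj311_realify311_iff _

/-- entry 3 READS «Δ_a(U) is positive definite». [cite: Balaban1985BackgroundPropagators, Thm 3.11 p.416 + (3.26) p.395] -/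
theorem posDefOfOps_ops311Y_three (U : CfgY (Matrix (Fin N) (Fin N) ℂ) x.toKIdx) :
    PosDefOfOps (ops311Y x 𝔏 𝔔) 3 U ↔ PosDefTr (fun _ => (1 : ℝ)) (deltaAY x.toKIdx 𝔏.parS 𝔏.parB 𝔏.Gp U) :=
  posDef_conj311_realify311_iff _

/-- entry 4 READS «G(U) is positive definite». [cite: Balaban1985BackgroundPropagators, Thm 3.11 p.416 + (3.27) p.395] -/
theorem posDefOfOps_ops311Y_four (U : CfgY (Matrix (Fin N) (Fin N) ℂ) x.toKIdx) :
    PosDefOfOps (ops311Y x 𝔏 𝔔) 4 U ↔ PosDefTr (fun _ => (1 : ℝ)) (𝔏.GA U) :=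
  posDef_conj311_realify311_iff _

/-! ## §3 The displayed schema in genuine currency and the discharge of the algebraic inputs -/

/-- **THE INPUTS OF THE PRINTED PROOF AT THE GENUINE LETTERS** — each clause a hypothesis of printed shape about def-Y's operators,
nothing asserted: `pos0` ∕ `symm0` — Δ′_a(U) positive and symmetric (*"obvious"*; (3.24), p. 394 regularity); `adj` — Q′\*(U) the adjoint
of Q′(U) for site weight 1 and block weight `W` (p. 393; [4] (2.69)); `qps_inj` — Q′\*(U) injective ([3] p. 25); `unitA` — Δ_a(U) invertible
(Thm 3.3 ∕ (3.106): G(U) = Δ_a(U)⁻¹ exists); `symmG` — G(U) symmetric; `posG0` — G₀ positive (*"Let us assume that the operator G₀ is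
positive"*); `fac` — G₀ = G(I − R) ((3.105)–(3.106)); `small` — ⟨Ψ, RΨ⟩ ≦ θ₁M⁻¹⟨Ψ, Ψ⟩ (*"(1 − O(M⁻¹))⟨A, A⟩"*; GAPS G-B9-06).  The clauses
`gp_right`, `c_right`, `da_right` of `Inputs311` are NOT here — they are theorems at the pins (`inputs311_ops311Y`).
[cite: Balaban1985BackgroundPropagators, Thm 3.11 proof p.416 + (3.24)–(3.27) pp.394–395 + (3.105)–(3.106) p.414; Balaban1984PropagatorsI, p.25] -/
structure Inputs311Y (θ₁ M : ℝ) (U : CfgY (Matrix (Fin N) (Fin N) ℂ) x.toKIdx) : Prop where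
  pos0 : PosDefTr (fun _ => (1 : ℝ)) (deltaPrimeAY x.toKIdx 𝔏.parS U)
  symm0 : IsSymmTr (fun _ => (1 : ℝ)) (deltaPrimeAY x.toKIdx 𝔏.parS U)
  adj : IsAdjTr (fun _ => (1 : ℝ)) (wB x.toKIdx) (QpY x.toKIdx 𝔏.parS U) (QpsY x.toKIdx 𝔏.parS U)
  qps_inj : Function.Injective (QpsY x.toKIdx 𝔏.parS U)
  unitA : IsUnit (deltaAY x.toKIdx 𝔏.parS 𝔏.parB 𝔏.Gp U)
  symmG : IsSymmTr (fun _ => (1 : ℝ)) (𝔏.GA U)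
  posG0 : PosDefTr (fun _ => (1 : ℝ)) (𝔔.G0 U)
  fac : 𝔔.G0 U = 𝔏.GA U ∘ₗ (1 - 𝔔.R U)
  small : ∀ Ψ : FBondY x.toKIdx → Matrix (Fin N) (Fin N) ℂ,
    trIP (fun _ => (1 : ℝ)) Ψ (𝔔.R U Ψ) ≤ θ₁ * M⁻¹ * trIP (fun _ => (1 : ℝ)) Ψ Ψ

variable {x 𝔏 𝔔}

/-- Δ′_a(U) positive ⇒ Δ′_a(U) is a unit, so def-Y's `GpY _ 𝔏.parS U = Ring.inverse Δ′_a(U)` is its two-sided inverse («G′ = (Δ′_a)⁻¹»).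
[cite: Balaban1985BackgroundPropagators, (3.25) p.395, Thm 3.11 p.416] -/
theorem isUnit_deltaPrimeAY_of_inputs311Y {θ₁ M : ℝ} {U : CfgY (Matrix (Fin N) (Fin N) ℂ) x.toKIdx} (h : Inputs311Y x 𝔏 𝔔 θ₁ M U) :
    IsUnit (deltaPrimeAY x.toKIdx 𝔏.parS U) :=
  isUnit_of_posDefTr h.pos0

/-- ★ **[3] p. 25 AT THE LETTERS**: under the displayed inputs and the pin `𝔏.Gp = GpY _ 𝔏.parS`, the genuine `(Q′G′²Q′\*)(U)` (def-Y `XY`) is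
positive definite for the block-volume scalar product, hence a UNIT — so `XinvY = Ring.inverse (Q′G′²Q′\*)(U)` is its two-sided inverse.
[cite: Balaban1984PropagatorsI, p.25; Balaban1985BackgroundPropagators, (3.25) p.395] -/
theorem isUnit_XY_of_inputs311Y (hGp : 𝔏.Gp = GpY x.toKIdx 𝔏.parS) {θ₁ M : ℝ} {U : CfgY (Matrix (Fin N) (Fin N) ℂ) x.toKIdx}
    (h : Inputs311Y x 𝔏 𝔔 θ₁ M U) : IsUnit (XY x.toKIdx 𝔏.parS 𝔏.Gp U) := by
  have hu0 : IsUnit (deltaPrimeAY x.toKIdx 𝔏.parS U) := isUnit_of_posDefTr h.pos0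
  have hright : ∀ v, conj311 (eS311 N x.toKIdx) (eS311 N x.toKIdx) (deltaPrimeAY x.toKIdx 𝔏.parS U)
      (conj311 (eS311 N x.toKIdx) (eS311 N x.toKIdx) (𝔏.Gp U) v) = v := fun v => by
    rw [hGp]; exact conj311_apply_conj311_inverse _ hu0 v
  have hsymm0 := (symm_conj311_realify311_iff (w := fun _ : SiteY x.toKIdx => (1 : ℝ)) (hw := fun _ => one_pos)
    (deltaPrimeAY x.toKIdx 𝔏.parS U)).mpr h.symm0
  have hg : ∀ u v, inner ℝ (conj311 (eS311 N x.toKIdx) (eS311 N x.toKIdx) (𝔏.Gp U) u) v =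
      inner ℝ u (conj311 (eS311 N x.toKIdx) (eS311 N x.toKIdx) (𝔏.Gp U) v) := fun u v => by
    conv_lhs => rw [← hright v]
    conv_rhs => rw [← hright u]
    exact (hsymm0 _ _).symm
  have hginj : Function.Injective (conj311 (eS311 N x.toKIdx) (eS311 N x.toKIdx) (𝔏.Gp U)) := fun u v huv => by
    rw [← hright u, ← hright v, huv]
  have hadj := (adj_conj311_realify311_iff (w := fun _ : SiteY x.toKIdx => (1 : ℝ)) (hw := fun _ => one_pos)
    (w' := wB x.toKIdx) (hw' := wB_pos x.toKIdx) (QpY x.toKIdx 𝔏.parS U) (QpsY x.toKIdx 𝔏.parS U)).mpr h.adj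
  have hqs := (injective_conj311_iff (eB311 N x.toKIdx) (eS311 N x.toKIdx) (QpsY x.toKIdx 𝔏.parS U)).mpr h.qps_inj
  have hpd := posDef_qggqs hadj hg hginj hqs
  have hconj : conj311 (eS311 N x.toKIdx) (eB311 N x.toKIdx) (QpY x.toKIdx 𝔏.parS U) ∘ₗ
      conj311 (eS311 N x.toKIdx) (eS311 N x.toKIdx) (𝔏.Gp U) ∘ₗ conj311 (eS311 N x.toKIdx) (eS311 N x.toKIdx) (𝔏.Gp U) ∘ₗ
        conj311 (eB311 N x.toKIdx) (eS311 N x.toKIdx) (QpsY x.toKIdx 𝔏.parS U) =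
      conj311 (eB311 N x.toKIdx) (eB311 N x.toKIdx) (XY x.toKIdx 𝔏.parS 𝔏.Gp U) := by
    rw [XY, conj311_comp (eY := eS311 N x.toKIdx), conj311_comp (eY := eS311 N x.toKIdx), conj311_comp (eY := eS311 N x.toKIdx)]
  change B9Thm311Data.PosDef (conj311 (eS311 N x.toKIdx) (eB311 N x.toKIdx) (QpY x.toKIdx 𝔏.parS U) ∘ₗ
      conj311 (eS311 N x.toKIdx) (eS311 N x.toKIdx) (𝔏.Gp U) ∘ₗ conj311 (eS311 N x.toKIdx) (eS311 N x.toKIdx) (𝔏.Gp U) ∘ₗ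
        conj311 (eB311 N x.toKIdx) (eS311 N x.toKIdx) (QpsY x.toKIdx 𝔏.parS U)) at hpd
  rw [hconj] at hpd
  exact isUnit_of_posDefTr ((posDef_conj311_realify311_iff _).mp hpd)

/-- ★★ **THE INPUTS OF `B9Thm311Whole` AT THE PINNED LETTERS FROM THE GENUINE-CURRENCY SCHEMA**: under the pins `𝔏.Gp = GpY _ 𝔏.parS` (G′ = (Δ′_a)⁻¹,
(3.25)) and `𝔏.GA = GAY _ 𝔏.parS 𝔏.parB 𝔏.Gp` (G = Δ_a⁻¹, (3.27)) — both `rfl` at def-Y's `lettersYOfRecord` — `Inputs311Y x 𝔏 𝔔 θ₁ M U` yields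
`Inputs311 (ops311Y x 𝔏 𝔔) θ₁ M U`; the clauses `gp_right` (Δ′_aG′ = I), `c_right` ((Q′G′²Q′\*)·C = I) and `da_right` (GΔ_a = I) are PROVED
(two-sided inverses of units, `isUnit_XY_of_inputs311Y`), the others transported through the orthonormal charts.
[cite: Balaban1985BackgroundPropagators, Thm 3.11 proof p.416 + (3.25)–(3.27) p.395; Balaban1984PropagatorsI, p.25] -/
theorem inputs311_ops311Y (hGp : 𝔏.Gp = GpY x.toKIdx 𝔏.parS) (hGA : 𝔏.GA = GAY x.toKIdx 𝔏.parS 𝔏.parB 𝔏.Gp) {θ₁ M : ℝ}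
    {U : CfgY (Matrix (Fin N) (Fin N) ℂ) x.toKIdx} (h : Inputs311Y x 𝔏 𝔔 θ₁ M U) : Inputs311 (ops311Y x 𝔏 𝔔) θ₁ M U where
  pos0 := (posDef_conj311_realify311_iff _).mpr h.pos0
  symm0 := (symm_conj311_realify311_iff _).mpr h.symm0
  gp_right v := by
    change conj311 (eS311 N x.toKIdx) (eS311 N x.toKIdx) (deltaPrimeAY x.toKIdx 𝔏.parS U)
      (conj311 (eS311 N x.toKIdx) (eS311 N x.toKIdx) (𝔏.Gp U) v) = v
    rw [hGp]
    exact conj311_apply_conj311_inverse _ (isUnit_deltaPrimeAY_of_inputs311Y h) v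
  adj := (adj_conj311_realify311_iff _ _).mpr h.adj
  qps_inj := (injective_conj311_iff _ _ _).mpr h.qps_inj
  c_right φ := by
    have hX := apply_inverse_of_isUnit (isUnit_XY_of_inputs311Y hGp h) ((eB311 N x.toKIdx).symm φ)
    have hX' := congrArg (eB311 N x.toKIdx) hX
    rw [LinearEquiv.apply_symm_apply] at hX'
    simpa [ops311Y, XY, XinvY] using hX'
  posG0 := (posDef_conj311_realify311_iff _).mpr h.posG0
  symmG := (symm_conj311_realify311_iff _).mpr h.symmG
  fac := by
    change conj311 (eF311 N x.toKIdx) (eF311 N x.toKIdx) (𝔔.G0 U) =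
      conj311 (eF311 N x.toKIdx) (eF311 N x.toKIdx) (𝔏.GA U) ∘ₗ (1 - conj311 (eF311 N x.toKIdx) (eF311 N x.toKIdx) (𝔔.R U))
    rw [h.fac, conj311_comp (eY := eF311 N x.toKIdx), conj311_one_sub]
  small := (small_conj311_realify311_iff _ _).mpr h.small
  da_right v := by
    change conj311 (eF311 N x.toKIdx) (eF311 N x.toKIdx) (𝔏.GA U)
      (conj311 (eF311 N x.toKIdx) (eF311 N x.toKIdx) (deltaAY x.toKIdx 𝔏.parS 𝔏.parB 𝔏.Gp U) v) = v
    rw [hGA]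
    exact conj311_inverse_apply_conj311 _ h.unitA v

end Carrier

/-! ## §4 Row 17 at the record's carriers: `opsYOfLetters` ∕ `opsYOfRecord` -/

section StageY

open scoped Matrix.Norms.L2Operator

variable {N : ℕ} (θ : Stage3Params) (Mstar : ℕ) (𝔏 : LettersY N θ Mstar) (𝔈 : ExpsY N θ Mstar)

/-- ★★ **ROW 17 OF THE N06 KNIT AT def-Y's OPERATOR LAYER `opsYOfLetters N θ M⋆ 𝔏 𝔈` WITH THE LETTERS PINNED**: for every letters family `𝔏`
whose `Gp` ∕ `GA` are def-Y's genuine `GpY` ∕ `GAY` (the pins `hGp`, `hGA` — `rfl` at `lettersYOfRecord`), free proof letters `𝔔` (G₀, R) and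
expansion letters `𝔈` with the positivity field pinned to the GENUINE reading (`hPD : (ops x).PosDef = PosDefOfOps (ops311Y x (𝔏 x) (𝔔 x))`),
the ONE displayed schema `Inputs311Y` (printed-shape clauses about the genuine Δ′_a(U), Q′(U), Q′\*(U), Δ_a(U), G(U), G₀, R under the
provisos M ≧ M₁, 0 < α₀, Mα₀ ≦ a₁, (3.35)) yields `B9.Thm311Printed c35Y geo9Y (bg9Y …) (fun x => (ops x).PosDef)` — whose entries now
SAY that the genuine five operators are positive definite (`posDefOfOps_ops311Y_*`).
[cite: Balaban1985BackgroundPropagators, Thm 3.11 p.416 + (3.24)–(3.27) pp.394–395 + (3.35) p.396; Balaban1984PropagatorsI, p.25] -/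
theorem t311_of_pins_opsYOfLetters (𝔔 : ∀ x : MemberY θ.d₆ θ.ℓ₆ θ.hd' θ.hL' θ.b₀ θ.b₁ Mstar, ProofLetters311 N x.toKIdx)
    (θ₁ a₁ M₁ : ℝ) (ha₁ : 0 < a₁) (hM₁ : 0 < M₁)
    (hGp : ∀ x : MemberY θ.d₆ θ.ℓ₆ θ.hd' θ.hL' θ.b₀ θ.b₁ Mstar, (𝔏 x).Gp = GpY x.toKIdx (𝔏 x).parS)
    (hGA : ∀ x : MemberY θ.d₆ θ.ℓ₆ θ.hd' θ.hL' θ.b₀ θ.b₁ Mstar, (𝔏 x).GA = GAY x.toKIdx (𝔏 x).parS (𝔏 x).parB (𝔏 x).Gp)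
    (h311 : ∀ x : MemberY θ.d₆ θ.ℓ₆ θ.hd' θ.hL' θ.b₀ θ.b₁ Mstar, M₁ ≤ (geo9Y x).M → ∀ α₀ : ℝ, 0 < α₀ → (geo9Y x).M * α₀ ≤ a₁ →
      ∀ U : (bg9Y (Matrix (Fin N) (Fin N) ℂ) (specialUnitaryUnits (Fin N)) x).Cfg,
        (bg9Y (Matrix (Fin N) (Fin N) ℂ) (specialUnitaryUnits (Fin N)) x).Reg335 c35Y α₀ U → Inputs311Y x (𝔏 x) (𝔔 x) θ₁ (geo9Y x).M U)
    (hPD : ∀ x : MemberY θ.d₆ θ.ℓ₆ θ.hd' θ.hL' θ.b₀ θ.b₁ Mstar,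
      ((opsYOfLetters N θ Mstar 𝔏 𝔈) x).PosDef = PosDefOfOps (ops311Y x (𝔏 x) (𝔔 x))) :
    B9.Thm311Printed c35Y geo9Y (bg9Y (Matrix (Fin N) (Fin N) ℂ) (specialUnitaryUnits (Fin N)))
      (fun x => ((opsYOfLetters N θ Mstar 𝔏 𝔈) x).PosDef) := by
  have hfun : (fun x => ((opsYOfLetters N θ Mstar 𝔏 𝔈) x).PosDef) = fun x => PosDefOfOps (ops311Y x (𝔏 x) (𝔔 x)) := funext hPD
  rw [hfun]
  exact thm311Printed_of_inputs (fun x => ops311Y x (𝔏 x) (𝔔 x)) θ₁ a₁ M₁ ha₁ hM₁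
    fun x hM α₀ hα₀ hMa U hU => inputs311_ops311Y (hGp x) (hGA x) (h311 x hM α₀ hα₀ hMa U hU)

/-- ★★ **ROW 17 AT THE LETTERS OF RECORD `opsYOfRecord N θ M⋆ 𝔈`** (def-Y `lettersYOfRecord`: `Gp := GpY …`, `GA := GAY …` by `rfl`): from the pin `hPD`
and the displayed schema ALONE — Theorem 3.11 at the instance now speaks about the genuine Δ′_a(U), G′(U), (Q′G′²Q′\*)⁻¹(U), Δ_a(U), G(U).
[cite: Balaban1985BackgroundPropagators, Thm 3.11 p.416 + (3.25)–(3.27) p.395 + (3.35) p.396] -/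
theorem t311_of_pins_opsYOfRecord (𝔔 : ∀ x : MemberY θ.d₆ θ.ℓ₆ θ.hd' θ.hL' θ.b₀ θ.b₁ Mstar, ProofLetters311 N x.toKIdx)
    (θ₁ a₁ M₁ : ℝ) (ha₁ : 0 < a₁) (hM₁ : 0 < M₁)
    (h311 : ∀ x : MemberY θ.d₆ θ.ℓ₆ θ.hd' θ.hL' θ.b₀ θ.b₁ Mstar, M₁ ≤ (geo9Y x).M → ∀ α₀ : ℝ, 0 < α₀ → (geo9Y x).M * α₀ ≤ a₁ →
      ∀ U : (bg9Y (Matrix (Fin N) (Fin N) ℂ) (specialUnitaryUnits (Fin N)) x).Cfg,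
        (bg9Y (Matrix (Fin N) (Fin N) ℂ) (specialUnitaryUnits (Fin N)) x).Reg335 c35Y α₀ U →
          Inputs311Y x (lettersYOfRecord N θ Mstar x) (𝔔 x) θ₁ (geo9Y x).M U)
    (hPD : ∀ x : MemberY θ.d₆ θ.ℓ₆ θ.hd' θ.hL' θ.b₀ θ.b₁ Mstar,
      ((opsYOfRecord N θ Mstar 𝔈) x).PosDef = PosDefOfOps (ops311Y x (lettersYOfRecord N θ Mstar x) (𝔔 x))) :
    B9.Thm311Printed c35Y geo9Y (bg9Y (Matrix (Fin N) (Fin N) ℂ) (specialUnitaryUnits (Fin N)))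
      (fun x => ((opsYOfRecord N θ Mstar 𝔈) x).PosDef) :=
  t311_of_pins_opsYOfLetters θ Mstar (lettersYOfRecord N θ Mstar) 𝔈 𝔔 θ₁ a₁ M₁ ha₁ hM₁ (fun _ => rfl) (fun _ => rfl) h311 hPD

end StageY

end

end Literature.MathematicalPhysics.QuantumFieldTheory.Balaban1983to89.B9Thm311ReadingAtLetters
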